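import Summits.Ventures.PercRepro.Night2LocalLossFairCount
import Summits.Ventures.PercRepro.Night2LocalThmE

/-!
# PercRepro — the coloops of `M|G` in the spanning sets and in the thin members (night-2, gen 18)

First structure facts for the cell proofs under the fair-share loss routing (`proofs/NIGHT-2-g18.md` §7, the
rigid cell), valid at every flat:

* every shadow set with closure `G` contains all the coloops of `M|G` (`coloops_subset_of_mem_shadowAt`);
* every THIN member below `G` contains all the coloops of `M|G` (`coloops_subset_of_mem_thinMembers`): a thin
  member missing the coloop `y` has its closure inside the rank-`q` flat `cl (G ∖ y)`, hence equal to it, and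
  then only `y` lies outside its closure — against `|G ∖ cl B| ≥ 2`;
* hence the rank of a thin member splits as `kColoops + ρ(B ∖ coloops)` (`eRk_eq_kColoops_add_sdiff`), so in the
  rigid cell `(q−1, q−2)` the part of a thin member off the coloops has rank exactly `2`.
-/

namespace PercRepro.Shadow

open Finset PerFlat ThmH

variable {α : Type*} [DecidableEq α] {M : Matroid α} [M.Finite]

/-- The coloops of `M|G`, as the filter defining `kColoops`. -/
theorem kColoops_eq_card_coloops (G : Finset α) : kColoops M G = (coloops M G).card := by
  unfold kColoops coloops
  rfl

open scoped Classical in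
/-- Every shadow set with closure `G` contains every coloop of `M|G`. -/
theorem coloops_subset_of_mem_shadowAt {q : ℕ} {G S : Finset α}
    (hS : S ∈ shadowAt M (q + 2) q (Uq M (q + 2) q) G) : coloops M G ⊆ S := by
  intro y hy
  rw [mem_coloops] at hy
  by_contra hyS
  have hSG : S ⊆ G := subset_G_of_mem_shadowAt hS
  have hcl : clF M S = G := (mem_shadowAt.1 hS).2
  have hsub : S ⊆ G.erase y := fun x hx => Finset.mem_erase.2 ⟨fun h => hyS (h ▸ hx), hSG hx⟩
  have : y ∈ clF M (G.erase y) := clF_mono hsub (hcl ▸ hy.1)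
  exact hy.2 this

/-- A coloop `y` of `M|G` (`G` a rank-`(q+1)` flat) has `ρ(G ∖ y) = q`. -/
theorem eRk_erase_of_mem_coloops {q : ℕ} {G : Finset α} (hG : G ∈ flatsQ M (q + 1)) {y : α}
    (hy : y ∈ coloops M G) : M.eRk ((G.erase y : Finset α) : Set α) = (q : ℕ∞) := by
  rw [mem_coloops] at hy
  have hGg : G ⊆ gr M := (mem_flatsQ.1 hG).1
  have hGr : M.eRk (G : Set α) = ((q + 1 : ℕ) : ℕ∞) := (mem_flatsQ.1 hG).2.2
  have hyE : y ∈ M.E \ M.closure ((G.erase y : Finset α) : Set α) := by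
    refine ⟨by rw [← coe_gr]; exact_mod_cast hGg hy.1, ?_⟩
    rw [← coe_clF]; exact_mod_cast hy.2
  have h1 : M.eRk ((insert y (G.erase y) : Finset α) : Set α) =
      M.eRk ((G.erase y : Finset α) : Set α) + 1 := by
    rw [Finset.coe_insert]; exact Matroid.eRk_insert_eq_add_one hyE
  rw [Finset.insert_erase hy.1, hGr] at h1
  have hfin : M.eRk ((G.erase y : Finset α) : Set α) ≠ ⊤ := by
    intro h; rw [h] at h1; exact absurd h1 (by simp)
  obtain ⟨n, hn⟩ := ENat.ne_top_iff_exists.1 hfin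
  rw [← hn] at h1 ⊢
  have : q + 1 = n + 1 := by exact_mod_cast h1
  congr 1; omega

open scoped Classical in
/-- Every thin member below `G` contains every coloop of `M|G` (`|E ∖ G| ≤ q`). -/
theorem coloops_subset_of_mem_thinMembers {q : ℕ} {G : Finset α} (hG : G ∈ flatsQ M (q + 1))
    (hd : (gr M \ G).card ≤ q) {B : Finset α} (hB : B ∈ thinMembers M q G) : coloops M G ⊆ B := by
  intro y hy
  by_contra hyB
  have hB' : B ∈ membersIn M (Uq M (q + 2) q) G := (mem_thinMembers.1 hB).1
  have hBU : B ∈ Uq M (q + 2) q := (mem_membersIn.1 hB').1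
  have hBG : clF M B ⊆ G := (mem_membersIn.1 hB').2
  have hm : 2 ≤ (G \ clF M B).card := two_le_card_sdiff_of_not_lay0 hG hd hB' (mem_thinMembers.1 hB).2
  have hGg : G ⊆ gr M := (mem_flatsQ.1 hG).1
  -- q ≥ 1 since the member forces a ground element outside G and |E ∖ G| ≤ q
  have hq1 : 1 ≤ q := le_trans (one_le_card_compl_of_member hG hBU) hd
  obtain ⟨q', rfl⟩ : ∃ q', q = q' + 1 := ⟨q - 1, by omega⟩
  -- B ⊆ G ∖ y, so cl B ⊆ cl (G ∖ y), a rank-q flat; cl B is a rank-q flat too, so they are equal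
  have hyG : y ∈ G := (mem_coloops.1 hy).1
  have hsub : B ⊆ G.erase y := fun x hx =>
    Finset.mem_erase.2 ⟨fun h => hyB (h ▸ hx), hBG (subset_clF hBU hx)⟩
  have hFe : clF M (G.erase y) ∈ flatsQ M (q' + 1) := by
    rw [mem_flatsQ, ← Finset.coe_subset, coe_clF, coe_gr]
    refine ⟨M.closure_subset_ground _, M.isFlat_closure _, ?_⟩
    rw [M.eRk_closure_eq]
    exact eRk_erase_of_mem_coloops hG hy
  have hF : clF M B ∈ flatsQ M (q' + 1) := clF_mem_flatsQ hBU
  have heq : clF M B = clF M (G.erase y) :=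
    flat_eq_of_subset_of_eRk_eq hFe (by rw [coe_clF]; exact M.isFlat_closure _) (clF_mono hsub)
      (mem_flatsQ.1 hF).2.2
  -- then G ∖ cl B ⊆ {y}
  have hGe : G.erase y ⊆ clF M B := by
    rw [heq]
    exact subset_clF_of_subset_gr ((Finset.erase_subset _ _).trans hGg)
  have hsing : G \ clF M B ⊆ {y} := by
    intro x hx
    rw [Finset.mem_sdiff] at hx
    rw [Finset.mem_singleton]
    by_contra hxy
    exact hx.2 (hGe (Finset.mem_erase.2 ⟨hxy, hx.1⟩))
  have := Finset.card_le_card hsing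
  rw [Finset.card_singleton] at this
  omega

open scoped Classical in
/-- The rank of a set `B ⊆ G` containing all the coloops of `M|G` splits as `kColoops + ρ(B ∖ coloops)`. -/
theorem eRk_eq_kColoops_add_sdiff {G : Finset α} (hG : G ⊆ gr M) {B : Finset α} (hBG : B ⊆ G)
    (hK : coloops M G ⊆ B) :
    M.eRk (B : Set α) = (kColoops M G : ℕ∞) + M.eRk ((B \ coloops M G : Finset α) : Set α) := by
  have hY : ∀ y ∈ coloops M G, y ∈ G ∧ y ∉ clF M (G.erase y) := fun y hy => mem_coloops.1 hy
  have hdisj : Disjoint (coloops M G) (B \ coloops M G) := Finset.disjoint_sdiff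
  have hunion : coloops M G ∪ (B \ coloops M G) = B := Finset.union_sdiff_of_subset hK
  rw [kColoops_eq_card_coloops, ← hunion]
  rw [eRk_union_coloops hG (coloops M G) hY (Finset.sdiff_subset.trans hBG) hdisj]
  rw [hunion]

open scoped Classical in
/-- In the rigid cell (`kColoops = q − 2`), the part of a thin member off the coloops has rank exactly `2`. -/
theorem eRk_sdiff_coloops_eq_two {q : ℕ} {G : Finset α} (hG : G ∈ flatsQ M (q + 1))
    (hd : (gr M \ G).card ≤ q) (hk : kColoops M G + 2 = q) {B : Finset α} (hB : B ∈ thinMembers M q G) :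
    M.eRk ((B \ coloops M G : Finset α) : Set α) = 2 := by
  have hB' : B ∈ membersIn M (Uq M (q + 2) q) G := (mem_thinMembers.1 hB).1
  have hBU : B ∈ Uq M (q + 2) q := (mem_membersIn.1 hB').1
  have hBG : B ⊆ G := (subset_clF hBU).trans (mem_membersIn.1 hB').2
  have hK := coloops_subset_of_mem_thinMembers hG hd hB
  have hr : M.eRk (B : Set α) = (q : ℕ∞) := (mem_Uq.1 hBU).2.1
  have h := eRk_eq_kColoops_add_sdiff (mem_flatsQ.1 hG).1 hBG hK
  rw [hr] at h
  have hfin : M.eRk ((B \ coloops M G : Finset α) : Set α) ≠ ⊤ := by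
    intro ht; rw [ht] at h; exact absurd h (by simp)
  obtain ⟨n, hn⟩ := ENat.ne_top_iff_exists.1 hfin
  rw [← hn] at h ⊢
  have : q = kColoops M G + n := by exact_mod_cast h
  have : n = 2 := by omega
  rw [this]; rfl

end PercRepro.Shadow
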